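import Summits.QuantumFields.YangMills.Theorems.CovariantDischargeAvgPlaqFluxReading
import Summits.QuantumFields.YangMills.Theorems.CovariantDischargeAvgPlaqFluxLocal
import HarnessLib

/-!
# Line «sandwich_discharge» on crux `HistoryTailL` (stmt-QuantumFields-19936), stub `stub_sandwichSweepGapCapped` (S′), B6 door row D6 (c)(d) —
# «THE LOCALISED READING»: the window statistic of `Ū^k[V](∂q)`, conjugated by the restricted gauge transformation, IS the linear
# reading of the one-stroke mean of the re-gauged link deviations over the translated-square family of `q`, to second order in a
# link bound that is needed ONLY on a set of bonds `B` containing the feeds of `q` and its one-stroke plaquettes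

Cell `ym3-torus` (YM ladder rung R3 = continuum SU(2) Yang–Mills on the three-torus — a RUNG, NOT the Clay problem); width seat `ym3-torus-px8` gen 7;
`--supports stmt-QuantumFields-19936` (helper).  THEOREMS ONLY (0 `def`, default heartbeats).

WHY (px8 g7 memo «B6 DOOR v3» D6 (c)(d), «modulo the consumer's localisation» of ✓`reading_iter_plaqHol_flux_linear_geometric`).  The (M2)(M3)
reading theorem wants a GLOBAL link bound `‖W_b − 1‖ ≤ s₀`; the door only has it for `W̃ := V^u` (`u` the comb∕axial gauge transformation) on a BALL
of bonds `B` (the comb-lasso Stokes letter ✓`CovariantDischargeCombLassoStokes.dist1_gaugeAct_axialT_le_of_ball`).  LOCALISE: `W′ := W̃` on `B`, `1` off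
`B`; then `W′` obeys the global bound, ✓`plaqHol_iter_eq_conj_of_eqOn_feeds` gives `Ū^k[W′](∂q) = u^{(k)}(q.src)·Ū^k[V](∂q)·u^{(k)}(q.src)⁻¹` as soon as
`B ⊇ feeds` of the four bonds of `q`, and ✓`circ_bondAvgIter_eq_sum` writes `L^k·circ(Q_k(W′ − 1))(q)` as the one-stroke sum over the translated-square
family — whose links are read off `W̃` as soon as they lie in `B`.  So, with NO global hypothesis on `V` beyond what `B` sees:
* §0 `reading_smul`, `reading_sum` (ℝ-linearity of `READ_v`);
* ★★ `reading_conj_iter_plaqHol_le` — `|⟪v, imVec su2Quat(u^{(k)}(q.src)·Ū^k[V](∂q)·u^{(k)}(q.src)⁻¹)⟫ − READ_v(M)| ≤ (|v₀|+|v₁|+|v₂|)·100·(4ℓ)^{2k}·s₀²`,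
  `M := (L^{dk})⁻¹ • Σ_{x ∈ B^k(q.src)} Σ_{s,t < L^k} [(W̃−1)⟨z,μ⟩ + (W̃−1)⟨z+e_μ,ν⟩ − (W̃−1)⟨z+e_ν,μ⟩ − (W̃−1)⟨z,ν⟩]`, `z = x + s e_μ + t e_ν` (ℓ = (d+2)L; guards
  `81ℓ(4ℓ)^k s₀ ≤ 1`, `2ℓ(4ℓ)^k s₀ < δ₂` as in the reading theorem).  In the door: `k = j`, `u = axialT V c₀`, `c₀ = embIter j p.src` ⇒ `u^{(j)}(p.src) = 1`
  (✓`CovariantDischargeDoorSites.transfUp_axialT_embIter`) and the window hypothesis is read exactly; `k = h` for the far plaquette.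
* ★ `abs_mean_reading_sub_mean_lin_le` — inside the one-stroke mean the plaquette reading `⟪v, imVec su2Quat(W̃(∂□z))⟫` and the linear reading
  `READ_v((W̃−1)(∂□z))` differ by `≤ (|v₀|+|v₁|+|v₂|)·13t²` per plaquette (✓`norm_plaq_four_sub_one_sub_lin_le` + ✓`abs_inner_imVec_su2Quat_sub_reading_le`),
  hence by `≤ (|v₀|+|v₁|+|v₂|)·13t²·(L^k)²` after the `(L^{dk})⁻¹`-normalised sum over the `L^{dk}·(L^k)²` one-stroke plaquettes (link bound `t ≤ 1` on `B`).
HONEST SCOPE: the reading rows of D6; nothing of the action side, the profile, S′∕`stub_sandwichSweepGapCapped`∕`HistoryTailL` proved or claimed;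
YM₃ on T³ is rung R3, not d = 4, not Clay. [cite: Balaban1985Averaging, (11)-(12) p.19, (19)-(20) p.21, Prop. 1 (51) p.26; Balaban1984PropagatorsI, (1.18) p.20]
-/

noncomputable section

open scoped BigOperators Matrix.Norms.L2Operator RealInnerProductSpace

namespace Summit.QuantumFields.YangMills.Theorems.CovariantDischargeDoorReading

open Literature.MathematicalPhysics.QuantumFieldTheory.Balaban1983to89
open Literature.MathematicalPhysics.QuantumLattice (su2Quat)
open Literature.MathematicalPhysics.QuantumFieldTheory.Balaban1983to89.T4ExpWindowSmallField (imVec)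
open T4Continuum BlockAveraging LatticeFieldCalculus ExpMeanLog
open B5Eq118OneStroke (iterBlock card_iterBlock)
open B14.Eq216Concrete (feeds)
open Summit.QuantumFields.YangMills.Theorems.CovariantDischargeAvgPlaqFluxReading (reading_iter_plaqHol_flux_linear_geometric abs_inner_imVec_su2Quat_sub_reading_le)
open Summit.QuantumFields.YangMills.Theorems.CovariantDischargeAvgPlaqFluxLinearIter (circ_bondAvgIter_eq_sum)
open Summit.QuantumFields.YangMills.Theorems.CovariantDischargeAvgPlaqFluxLocal (plaqHol_iter_eq_conj_of_eqOn_feeds)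
open Summit.QuantumFields.YangMills.Theorems.CovariantDischargeAvgPlaqFluxLinear (norm_plaq_four_sub_one_sub_lin_le)

variable {P : Params}

/-! ## §0 The linear reading is ℝ-linear in the matrix -/

/-- `READ_v(c • M) = c·READ_v(M)` for real `c`. [folklore] -/
theorem reading_smul (v : EuclideanSpace ℝ (Fin 3)) (c : ℝ) (M : Matrix (Fin 2) (Fin 2) ℂ) :
    v 0 * ((c • M) 0 0).im + v 1 * ((c • M) 0 1).re + v 2 * ((c • M) 0 1).im =
      c * (v 0 * (M 0 0).im + v 1 * (M 0 1).re + v 2 * (M 0 1).im) := by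
  simp only [Matrix.smul_apply, Complex.real_smul, Complex.mul_im, Complex.mul_re, Complex.ofReal_re, Complex.ofReal_im,
    zero_mul, sub_zero, add_zero]
  ring

/-- `READ_v(Σ Mᵢ) = Σ READ_v(Mᵢ)`. [folklore] -/
theorem reading_sum {ι : Type*} (v : EuclideanSpace ℝ (Fin 3)) (S : Finset ι) (f : ι → Matrix (Fin 2) (Fin 2) ℂ) :
    v 0 * ((∑ i ∈ S, f i) 0 0).im + v 1 * ((∑ i ∈ S, f i) 0 1).re + v 2 * ((∑ i ∈ S, f i) 0 1).im =
      ∑ i ∈ S, (v 0 * (f i 0 0).im + v 1 * (f i 0 1).re + v 2 * (f i 0 1).im) := by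
  simp only [Matrix.sum_apply, Complex.im_sum, Complex.re_sum, Finset.mul_sum, Finset.sum_add_distrib]

/-! ## §1 The localised reading -/

/-- ★★ **THE LOCALISED READING.** `V` any fine field, `u` any finest-lattice gauge transformation, `W̃ := V^u`, `B` a set of fine bonds on which
`‖W̃_b − 1‖ ≤ s₀` (`81ℓ(4ℓ)^k s₀ ≤ 1`, `2ℓ(4ℓ)^k s₀ < δ₂`), `q` a plaquette of `T^{(k)}` (`k ≤ m + K`) whose four bonds are fed inside `B` and whose
translated-square family's links lie in `B`.  Then for every `v ∈ ℝ³` and the one-stroke mean `M` of the re-gauged link deviations,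
`|⟪v, imVec su2Quat(u^{(k)}(q.src)·Ū^k[V](∂q)·u^{(k)}(q.src)⁻¹)⟫ − (v₀·Im M₀₀ + v₁·Re M₀₁ + v₂·Im M₀₁)| ≤ (|v₀|+|v₁|+|v₂|)·100·(4ℓ)^{2k}·s₀²`.
[cite: Balaban1985Averaging, (11)-(12) p.19 and Prop. 1 (51) p.26; Balaban1984PropagatorsI, (1.18) p.20] -/
theorem reading_conj_iter_plaqHol_le {k : ℕ} (hk : k ≤ P.m + P.K) (V : GaugeField P 0 (Matrix.specialUnitaryGroup (Fin 2) ℂ))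
    (u : GaugeTransf P 0 (Matrix.specialUnitaryGroup (Fin 2) ℂ)) (B : Set (PBond P 0)) {s₀ : ℝ} (hs₀ : 0 ≤ s₀)
    (hB : ∀ b ∈ B, ‖((GaugeField.gaugeAct u V b : Matrix.specialUnitaryGroup (Fin 2) ℂ) : Matrix (Fin 2) (Fin 2) ℂ) - 1‖ ≤ s₀)
    (h81 : 81 * (((P.d + 2) * P.L : ℕ) : ℝ) * ((4 * (((P.d + 2) * P.L : ℕ) : ℝ)) ^ k * s₀) ≤ 1)
    (hN : 2 * ((((P.d + 2) * P.L : ℕ) : ℝ) * ((4 * (((P.d + 2) * P.L : ℕ) : ℝ)) ^ k * s₀)) < deltaSU (Fin 2))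
    (q : Plaq P k)
    (hf₁ : feeds k (⟨q.src, q.μ⟩ : PBond P k) ⊆ B) (hf₂ : feeds k (⟨q.src.shift q.μ, q.ν⟩ : PBond P k) ⊆ B)
    (hf₃ : feeds k (⟨q.src.shift q.ν, q.μ⟩ : PBond P k) ⊆ B) (hf₄ : feeds k (⟨q.src, q.ν⟩ : PBond P k) ⊆ B)
    (hsq : ∀ x ∈ iterBlock k q.src, ∀ s ∈ Finset.range (P.L ^ k), ∀ t ∈ Finset.range (P.L ^ k),
      (⟨runSite (runSite x q.μ s) q.ν t, q.μ⟩ : PBond P 0) ∈ B ∧ (⟨runSite (runSite (runSite x q.μ s) q.ν t) q.μ 1, q.ν⟩ : PBond P 0) ∈ B ∧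
      (⟨runSite (runSite (runSite x q.μ s) q.ν t) q.ν 1, q.μ⟩ : PBond P 0) ∈ B ∧ (⟨runSite (runSite x q.μ s) q.ν t, q.ν⟩ : PBond P 0) ∈ B)
    (v : EuclideanSpace ℝ (Fin 3)) (M : Matrix (Fin 2) (Fin 2) ℂ)
    (hM : M = ((((P.L : ℝ) ^ P.d) ^ k)⁻¹) • ∑ x ∈ iterBlock k q.src, ∑ s ∈ Finset.range (P.L ^ k), ∑ t ∈ Finset.range (P.L ^ k),
      ((((GaugeField.gaugeAct u V ⟨runSite (runSite x q.μ s) q.ν t, q.μ⟩ : Matrix.specialUnitaryGroup (Fin 2) ℂ) : Matrix (Fin 2) (Fin 2) ℂ) - 1) +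
        (((GaugeField.gaugeAct u V ⟨runSite (runSite (runSite x q.μ s) q.ν t) q.μ 1, q.ν⟩ : Matrix.specialUnitaryGroup (Fin 2) ℂ) : Matrix (Fin 2) (Fin 2) ℂ) - 1) -
        (((GaugeField.gaugeAct u V ⟨runSite (runSite (runSite x q.μ s) q.ν t) q.ν 1, q.μ⟩ : Matrix.specialUnitaryGroup (Fin 2) ℂ) : Matrix (Fin 2) (Fin 2) ℂ) - 1) -
        (((GaugeField.gaugeAct u V ⟨runSite (runSite x q.μ s) q.ν t, q.ν⟩ : Matrix.specialUnitaryGroup (Fin 2) ℂ) : Matrix (Fin 2) (Fin 2) ℂ) - 1))) :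
    |⟪v, imVec (su2Quat (transfUp u k q.src *
          GaugeField.plaqHol (Averaging.iter (fun i => BlockAveraging.blockAvg (P := P) (j := i) (expMeanLogSU (n := Fin 2))) k V) q *
          (transfUp u k q.src)⁻¹))⟫ - (v 0 * (M 0 0).im + v 1 * (M 0 1).re + v 2 * (M 0 1).im)| ≤
      (|v 0| + |v 1| + |v 2|) * (100 * ((4 * (((P.d + 2) * P.L : ℕ) : ℝ)) ^ k) ^ 2 * s₀ ^ 2) := by
  classical
  -- the localised field
  set W' : GaugeField P 0 (Matrix.specialUnitaryGroup (Fin 2) ℂ) := fun b => if b ∈ B then GaugeField.gaugeAct u V b else 1 with hW'def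
  have hW'B : ∀ b ∈ B, W' b = GaugeField.gaugeAct u V b := fun b hb => by simp only [hW'def, if_pos hb]
  have hW' : ∀ b, ‖((W' b : Matrix.specialUnitaryGroup (Fin 2) ℂ) : Matrix (Fin 2) (Fin 2) ℂ) - 1‖ ≤ s₀ := by
    intro b
    by_cases hb : b ∈ B
    · rw [hW'B b hb]; exact hB b hb
    · have : W' b = 1 := by simp only [hW'def, if_neg hb]
      rw [this]
      simp [hs₀]
  have hread := reading_iter_plaqHol_flux_linear_geometric hk W' hs₀ hW' h81 hN q v
  -- (i) the averaged plaquette of `W'` is the conjugate of that of `V`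
  have hplaq : GaugeField.plaqHol (Averaging.iter (fun i => BlockAveraging.blockAvg (P := P) (j := i) (expMeanLogSU (n := Fin 2))) k W') q =
      transfUp u k q.src * GaugeField.plaqHol (Averaging.iter (fun i => BlockAveraging.blockAvg (P := P) (j := i) (expMeanLogSU (n := Fin 2))) k V) q *
        (transfUp u k q.src)⁻¹ :=
    plaqHol_iter_eq_conj_of_eqOn_feeds _ hk W' V u q (fun b₀ hb₀ => hW'B b₀ (hf₁ hb₀)) (fun b₀ hb₀ => hW'B b₀ (hf₂ hb₀))
      (fun b₀ hb₀ => hW'B b₀ (hf₃ hb₀)) (fun b₀ hb₀ => hW'B b₀ (hf₄ hb₀))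
  -- (ii) the averaged circulation of `W' − 1` is the one-stroke mean, read off `W̃` on `B`
  have hcirc := circ_bondAvgIter_eq_sum hk (fun b => ((W' b : Matrix.specialUnitaryGroup (Fin 2) ℂ) : Matrix (Fin 2) (Fin 2) ℂ) - 1) q
  have hsum : (∑ x ∈ iterBlock k q.src, ∑ s ∈ Finset.range (P.L ^ k), ∑ t ∈ Finset.range (P.L ^ k),
      ((((W' ⟨runSite (runSite x q.μ s) q.ν t, q.μ⟩ : Matrix.specialUnitaryGroup (Fin 2) ℂ) : Matrix (Fin 2) (Fin 2) ℂ) - 1) +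
        (((W' ⟨runSite (runSite (runSite x q.μ s) q.ν t) q.μ 1, q.ν⟩ : Matrix.specialUnitaryGroup (Fin 2) ℂ) : Matrix (Fin 2) (Fin 2) ℂ) - 1) -
        (((W' ⟨runSite (runSite (runSite x q.μ s) q.ν t) q.ν 1, q.μ⟩ : Matrix.specialUnitaryGroup (Fin 2) ℂ) : Matrix (Fin 2) (Fin 2) ℂ) - 1) -
        (((W' ⟨runSite (runSite x q.μ s) q.ν t, q.ν⟩ : Matrix.specialUnitaryGroup (Fin 2) ℂ) : Matrix (Fin 2) (Fin 2) ℂ) - 1))) =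
      ∑ x ∈ iterBlock k q.src, ∑ s ∈ Finset.range (P.L ^ k), ∑ t ∈ Finset.range (P.L ^ k),
      ((((GaugeField.gaugeAct u V ⟨runSite (runSite x q.μ s) q.ν t, q.μ⟩ : Matrix.specialUnitaryGroup (Fin 2) ℂ) : Matrix (Fin 2) (Fin 2) ℂ) - 1) +
        (((GaugeField.gaugeAct u V ⟨runSite (runSite (runSite x q.μ s) q.ν t) q.μ 1, q.ν⟩ : Matrix.specialUnitaryGroup (Fin 2) ℂ) : Matrix (Fin 2) (Fin 2) ℂ) - 1) -
        (((GaugeField.gaugeAct u V ⟨runSite (runSite (runSite x q.μ s) q.ν t) q.ν 1, q.μ⟩ : Matrix.specialUnitaryGroup (Fin 2) ℂ) : Matrix (Fin 2) (Fin 2) ℂ) - 1) -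
        (((GaugeField.gaugeAct u V ⟨runSite (runSite x q.μ s) q.ν t, q.ν⟩ : Matrix.specialUnitaryGroup (Fin 2) ℂ) : Matrix (Fin 2) (Fin 2) ℂ) - 1)) := by
    refine Finset.sum_congr rfl fun x hx => Finset.sum_congr rfl fun s hs => Finset.sum_congr rfl fun t ht => ?_
    obtain ⟨h1, h2, h3, h4⟩ := hsq x hx s hs t ht
    rw [hW'B _ h1, hW'B _ h2, hW'B _ h3, hW'B _ h4]
  rw [hplaq, hcirc, hsum, ← hM] at hread
  exact hread

/-! ## §2 Inside the one-stroke mean: plaquette reading against linear reading -/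

/-- ★ **PLAQUETTE READING vs LINEAR READING, SUMMED OVER THE ONE-STROKE FAMILY.** If the four links of every one-stroke plaquette `□z`
(`z = x + s e_μ + t e_ν`, `x ∈ B^k(y)`, `s, t < L^k`) of the re-gauged field `W̃ = V^u` are within `t₀ ≤ 1` of `1`, then
`|(L^{dk})⁻¹·Σ ⟪v, imVec su2Quat(W̃(∂□z))⟫ − (v₀·Im M₀₀ + v₁·Re M₀₁ + v₂·Im M₀₁)| ≤ (|v₀|+|v₁|+|v₂|)·13·t₀²·(L^k)²` with `M` the one-stroke mean of §1
(`k ≤ m + K` for `#B^k(y) = L^{dk}`). [cite: Balaban1985Averaging, (19)-(20) p.21; Balaban1984PropagatorsI, (1.6) p.18] -/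
theorem abs_mean_reading_sub_mean_lin_le {k : ℕ} (hk : k ≤ P.m + P.K) (W : GaugeField P 0 (Matrix.specialUnitaryGroup (Fin 2) ℂ))
    (y : Site P k) (μ ν : Fin P.d) (hμν : μ < ν) {t₀ : ℝ} (ht₀ : 0 ≤ t₀) (ht₁ : t₀ ≤ 1)
    (hW : ∀ x ∈ iterBlock k y, ∀ s ∈ Finset.range (P.L ^ k), ∀ t ∈ Finset.range (P.L ^ k),
      ‖((W ⟨runSite (runSite x μ s) ν t, μ⟩ : Matrix.specialUnitaryGroup (Fin 2) ℂ) : Matrix (Fin 2) (Fin 2) ℂ) - 1‖ ≤ t₀ ∧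
      ‖((W ⟨(runSite (runSite x μ s) ν t).shift μ, ν⟩ : Matrix.specialUnitaryGroup (Fin 2) ℂ) : Matrix (Fin 2) (Fin 2) ℂ) - 1‖ ≤ t₀ ∧
      ‖((W ⟨(runSite (runSite x μ s) ν t).shift ν, μ⟩ : Matrix.specialUnitaryGroup (Fin 2) ℂ) : Matrix (Fin 2) (Fin 2) ℂ) - 1‖ ≤ t₀ ∧
      ‖((W ⟨runSite (runSite x μ s) ν t, ν⟩ : Matrix.specialUnitaryGroup (Fin 2) ℂ) : Matrix (Fin 2) (Fin 2) ℂ) - 1‖ ≤ t₀)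
    (v : EuclideanSpace ℝ (Fin 3)) (M : Matrix (Fin 2) (Fin 2) ℂ)
    (hM : M = ((((P.L : ℝ) ^ P.d) ^ k)⁻¹) • ∑ x ∈ iterBlock k y, ∑ s ∈ Finset.range (P.L ^ k), ∑ t ∈ Finset.range (P.L ^ k),
      ((((W ⟨runSite (runSite x μ s) ν t, μ⟩ : Matrix.specialUnitaryGroup (Fin 2) ℂ) : Matrix (Fin 2) (Fin 2) ℂ) - 1) +
        (((W ⟨(runSite (runSite x μ s) ν t).shift μ, ν⟩ : Matrix.specialUnitaryGroup (Fin 2) ℂ) : Matrix (Fin 2) (Fin 2) ℂ) - 1) -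
        (((W ⟨(runSite (runSite x μ s) ν t).shift ν, μ⟩ : Matrix.specialUnitaryGroup (Fin 2) ℂ) : Matrix (Fin 2) (Fin 2) ℂ) - 1) -
        (((W ⟨runSite (runSite x μ s) ν t, ν⟩ : Matrix.specialUnitaryGroup (Fin 2) ℂ) : Matrix (Fin 2) (Fin 2) ℂ) - 1))) :
    |((((P.L : ℝ) ^ P.d) ^ k)⁻¹) * ∑ x ∈ iterBlock k y, ∑ s ∈ Finset.range (P.L ^ k), ∑ t ∈ Finset.range (P.L ^ k),
        ⟪v, imVec (su2Quat (GaugeField.plaqHol W ⟨runSite (runSite x μ s) ν t, μ, ν, hμν⟩))⟫ -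
      (v 0 * (M 0 0).im + v 1 * (M 0 1).re + v 2 * (M 0 1).im)| ≤
      (|v 0| + |v 1| + |v 2|) * (13 * t₀ ^ 2) * ((P.L : ℝ) ^ k) ^ 2 := by
  have hL : (0 : ℝ) < ((P.L : ℝ) ^ P.d) ^ k := by have := P.L_pos; positivity
  -- the reading is ℝ-linear in the matrix: pull it through the normalised sum
  have hlin : v 0 * (M 0 0).im + v 1 * (M 0 1).re + v 2 * (M 0 1).im =
      ((((P.L : ℝ) ^ P.d) ^ k)⁻¹) * ∑ x ∈ iterBlock k y, ∑ s ∈ Finset.range (P.L ^ k), ∑ t ∈ Finset.range (P.L ^ k),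
        (v 0 * ((((((W ⟨runSite (runSite x μ s) ν t, μ⟩ : Matrix.specialUnitaryGroup (Fin 2) ℂ) : Matrix (Fin 2) (Fin 2) ℂ) - 1) +
        (((W ⟨(runSite (runSite x μ s) ν t).shift μ, ν⟩ : Matrix.specialUnitaryGroup (Fin 2) ℂ) : Matrix (Fin 2) (Fin 2) ℂ) - 1) -
        (((W ⟨(runSite (runSite x μ s) ν t).shift ν, μ⟩ : Matrix.specialUnitaryGroup (Fin 2) ℂ) : Matrix (Fin 2) (Fin 2) ℂ) - 1) -
        (((W ⟨runSite (runSite x μ s) ν t, ν⟩ : Matrix.specialUnitaryGroup (Fin 2) ℂ) : Matrix (Fin 2) (Fin 2) ℂ) - 1)) 0 0).im) +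
         v 1 * ((((((W ⟨runSite (runSite x μ s) ν t, μ⟩ : Matrix.specialUnitaryGroup (Fin 2) ℂ) : Matrix (Fin 2) (Fin 2) ℂ) - 1) +
        (((W ⟨(runSite (runSite x μ s) ν t).shift μ, ν⟩ : Matrix.specialUnitaryGroup (Fin 2) ℂ) : Matrix (Fin 2) (Fin 2) ℂ) - 1) -
        (((W ⟨(runSite (runSite x μ s) ν t).shift ν, μ⟩ : Matrix.specialUnitaryGroup (Fin 2) ℂ) : Matrix (Fin 2) (Fin 2) ℂ) - 1) -
        (((W ⟨runSite (runSite x μ s) ν t, ν⟩ : Matrix.specialUnitaryGroup (Fin 2) ℂ) : Matrix (Fin 2) (Fin 2) ℂ) - 1)) 0 1).re) +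
         v 2 * ((((((W ⟨runSite (runSite x μ s) ν t, μ⟩ : Matrix.specialUnitaryGroup (Fin 2) ℂ) : Matrix (Fin 2) (Fin 2) ℂ) - 1) +
        (((W ⟨(runSite (runSite x μ s) ν t).shift μ, ν⟩ : Matrix.specialUnitaryGroup (Fin 2) ℂ) : Matrix (Fin 2) (Fin 2) ℂ) - 1) -
        (((W ⟨(runSite (runSite x μ s) ν t).shift ν, μ⟩ : Matrix.specialUnitaryGroup (Fin 2) ℂ) : Matrix (Fin 2) (Fin 2) ℂ) - 1) -
        (((W ⟨runSite (runSite x μ s) ν t, ν⟩ : Matrix.specialUnitaryGroup (Fin 2) ℂ) : Matrix (Fin 2) (Fin 2) ℂ) - 1)) 0 1).im)) := by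
    rw [hM, reading_smul]
    simp only [reading_sum]
  rw [hlin, ← mul_sub, ← Finset.sum_sub_distrib]
  simp_rw [← Finset.sum_sub_distrib]
  rw [abs_mul, abs_of_pos (inv_pos.mpr hL)]
  -- per plaquette
  have hper : ∀ x ∈ iterBlock k y, ∀ s ∈ Finset.range (P.L ^ k), ∀ t ∈ Finset.range (P.L ^ k),
      |⟪v, imVec (su2Quat (GaugeField.plaqHol W ⟨runSite (runSite x μ s) ν t, μ, ν, hμν⟩))⟫ -
        (v 0 * ((((((W ⟨runSite (runSite x μ s) ν t, μ⟩ : Matrix.specialUnitaryGroup (Fin 2) ℂ) : Matrix (Fin 2) (Fin 2) ℂ) - 1) +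
        (((W ⟨(runSite (runSite x μ s) ν t).shift μ, ν⟩ : Matrix.specialUnitaryGroup (Fin 2) ℂ) : Matrix (Fin 2) (Fin 2) ℂ) - 1) -
        (((W ⟨(runSite (runSite x μ s) ν t).shift ν, μ⟩ : Matrix.specialUnitaryGroup (Fin 2) ℂ) : Matrix (Fin 2) (Fin 2) ℂ) - 1) -
        (((W ⟨runSite (runSite x μ s) ν t, ν⟩ : Matrix.specialUnitaryGroup (Fin 2) ℂ) : Matrix (Fin 2) (Fin 2) ℂ) - 1)) 0 0).im) +
         v 1 * ((((((W ⟨runSite (runSite x μ s) ν t, μ⟩ : Matrix.specialUnitaryGroup (Fin 2) ℂ) : Matrix (Fin 2) (Fin 2) ℂ) - 1) +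
        (((W ⟨(runSite (runSite x μ s) ν t).shift μ, ν⟩ : Matrix.specialUnitaryGroup (Fin 2) ℂ) : Matrix (Fin 2) (Fin 2) ℂ) - 1) -
        (((W ⟨(runSite (runSite x μ s) ν t).shift ν, μ⟩ : Matrix.specialUnitaryGroup (Fin 2) ℂ) : Matrix (Fin 2) (Fin 2) ℂ) - 1) -
        (((W ⟨runSite (runSite x μ s) ν t, ν⟩ : Matrix.specialUnitaryGroup (Fin 2) ℂ) : Matrix (Fin 2) (Fin 2) ℂ) - 1)) 0 1).re) +
         v 2 * ((((((W ⟨runSite (runSite x μ s) ν t, μ⟩ : Matrix.specialUnitaryGroup (Fin 2) ℂ) : Matrix (Fin 2) (Fin 2) ℂ) - 1) +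
        (((W ⟨(runSite (runSite x μ s) ν t).shift μ, ν⟩ : Matrix.specialUnitaryGroup (Fin 2) ℂ) : Matrix (Fin 2) (Fin 2) ℂ) - 1) -
        (((W ⟨(runSite (runSite x μ s) ν t).shift ν, μ⟩ : Matrix.specialUnitaryGroup (Fin 2) ℂ) : Matrix (Fin 2) (Fin 2) ℂ) - 1) -
        (((W ⟨runSite (runSite x μ s) ν t, ν⟩ : Matrix.specialUnitaryGroup (Fin 2) ℂ) : Matrix (Fin 2) (Fin 2) ℂ) - 1)) 0 1).im))|
        ≤ (|v 0| + |v 1| + |v 2|) * (13 * t₀ ^ 2) := by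
    intro x hx s hs t ht
    obtain ⟨h1, h2, h3, h4⟩ := hW x hx s hs t ht
    exact abs_inner_imVec_su2Quat_sub_reading_le v _ _ (norm_plaq_four_sub_one_sub_lin_le _ _ _ _ ht₀ ht₁ h1 h2 h3 h4)
  -- sum and count
  have hcount : ∑ x ∈ iterBlock k y, ∑ s ∈ Finset.range (P.L ^ k), ∑ t ∈ Finset.range (P.L ^ k), (|v 0| + |v 1| + |v 2|) * (13 * t₀ ^ 2) =
      ((P.L : ℝ) ^ P.d) ^ k * ((|v 0| + |v 1| + |v 2|) * (13 * t₀ ^ 2) * ((P.L : ℝ) ^ k) ^ 2) := by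
    simp only [Finset.sum_const, Finset.card_range, nsmul_eq_mul, card_iterBlock k hk]
    push_cast
    ring
  calc (((P.L : ℝ) ^ P.d) ^ k)⁻¹ * |∑ x ∈ iterBlock k y, ∑ s ∈ Finset.range (P.L ^ k), ∑ t ∈ Finset.range (P.L ^ k), _|
      ≤ (((P.L : ℝ) ^ P.d) ^ k)⁻¹ * ∑ x ∈ iterBlock k y, ∑ s ∈ Finset.range (P.L ^ k), ∑ t ∈ Finset.range (P.L ^ k),
          (|v 0| + |v 1| + |v 2|) * (13 * t₀ ^ 2) := by
        refine mul_le_mul_of_nonneg_left ?_ (inv_nonneg.mpr hL.le)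
        refine (Finset.abs_sum_le_sum_abs _ _).trans (Finset.sum_le_sum fun x hx => ?_)
        refine (Finset.abs_sum_le_sum_abs _ _).trans (Finset.sum_le_sum fun s hs => ?_)
        exact (Finset.abs_sum_le_sum_abs _ _).trans (Finset.sum_le_sum fun t ht => hper x hx s hs t ht)
    _ = (|v 0| + |v 1| + |v 2|) * (13 * t₀ ^ 2) * ((P.L : ℝ) ^ k) ^ 2 := by
        rw [hcount, ← mul_assoc, inv_mul_cancel₀ hL.ne', one_mul]

end Summit.QuantumFields.YangMills.Theorems.CovariantDischargeDoorReading
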